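import Summits.AtomisticToContinuum.Crystallization.Theorems.ChartedPlanarOrderDensityDichotomyDoor
import Summits.AtomisticToContinuum.Crystallization.Theorems.ChartedPlanarOrderDensityDichotomyFloor

/-!
# «MesoCut» — RED♮ typed beneath BULK|door (decomp-a2c lens-3 g21/g22; critic row 380 (2)(b) ORDER)

Blocker of record: N = `Theses.ChartedPlanarOrder.ChartedZeroExcessLayered` (stmt-AtomisticToContinuum-26636); the door
(`RigidityDoor`, p812416) consumes `SparseMisfit ν`, and after lens-2 g21 (tree p814147/p814228/p814365) the door's cone below R⋆
contains `BulkDefectGap` ONLY (K5′ `sparseMisfit_of_bulk`).  Critic row 380 (1): BULK|door is THE BOTTLENECK RESIDUAL OF RECORD;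
(2)(b): the ONLY place where N's binders (`IsClean ∧ IsNash ∧ IsCharted`) can still pay is the INHOMOGENEOUS REDUCTION of BULK|door:

  BULK|door ⟸ HBG♮ «near-homogeneous bulk gap» (= lens-2's census-facing HBG `HomogeneousBulkGap` transported to chunks whose
              `r`-environments are `τ`-close to ONE homogeneously deformed LAYERED structure `LayeredHom L w` — v2, critic row 385
              C′: FREE per-layer rigid translations `w` (inner displacements!), `HomStacking L s z` being the special case
              `homStacking_eq_layeredHom` — CB-coercivity of the INNER-RELAXED energies (TAG 139′ = HBC-CERT′) + CB-locality
              (TRUE·M lattice sums); manifestly WEAKER than BULK: K0)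
            ∧ RED♮ «MESOSCOPIC HOMOGENISATION» (`MesoHomogenisation`, Nash-ESSENTIAL, GS-free, ENERGY-FREE: in a door configuration
              whose root window is densely `θ`-bad, a `c₀(u)`-fraction of the window is carried by pairwise disjoint sub-chunks each of
              which is `(τ, r)`-near-homogeneous and ENTIRELY `θ'`-bad, with small total boundary; census input TAG 138 (ii) =
              Legendre–Hadamard ellipticity across the (1/16, 9/10, 1)-clean window)
            ∧ Floor♭ (`ChunkFloor`, PROVED: `chunkFloor_holds`).

KERNELS (0 sorry): K0 `nearHomBulkGap_of_bulk` · K1 `bulkDoor_of_bulk` (BULK|door ≤ BULK) · K2 ★ `bulkDoor_of_meso`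
(Floor♭ ∧ HBG♮ ∧ RED♮ ⟹ BULK|door; two-scale bookkeeping over the sub-chunk partition) · K3 `sparseMisfit_of_bulkDoor`
(K5′ verbatim with `R ≥ R₀`: the door consumes BULK|door) · K4 `gap_and_pert_1_50_of_bulkDoor` / `gap_and_pert_1_50_of_meso`
(the node of record: DOOR ∧ SparseNull(≤ 1/16) ∧ BindingSurface ∧ WindowCounting ∧ HBG♮ ∧ RED♮ ⟹ VisibleGap (1/50) ∧ PertRegime (1/50)).

Hypothesis discipline: `IsClean ∧ IsNash ∧ IsCharted` enter verbatim through `IsDoorSet`; `IsEStarGSC` only through `BindingSurface`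
(K3); `MuEquilibriumDoor` stays a hypothesis (K4).  LAND candidate (decision: critic row 385 (2): v2 then hand-1 lands): `Theorems/ChartedPlanarOrderMesoCut.lean --supports stmt-AtomisticToContinuum-26636 --as helper` (Prop defs ⇒ review kind definition; theses-cone WARNING expected as for the Door file).

LANDING NOTE (hand-1 g8, critic row 389 (2)): the 503-line twin 7c1db3b2 is split for the 400-line lint — THIS module = §§1–4
(definitions, bookkeeping, kernels K0–K2 + `bulkDoor_of_rigidity`); `Theorems/ChartedPlanarOrderMesoCutDoor.lean` (same namespace) = §§5–7
(K3 `sparseMisfit_of_bulkDoor`, K4, and the `_final` forms with SparseNull/WindowCounting/BindingSurface discharged by name).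

v2 (critic row 385 «INNER DISPLACEMENT», class refuted-MISSTATED of v1's `NearHom` over `HomStacking`: hcp under 2 % in-plane shear
relaxes by an inner displacement ≈ 0.017 a₀ of the B layers that no `HomStacking` represents ⇒ v1-RED♮ false as typed at
(δ, θ, u) = (7/10, 1/100, 1/2)): `NearHom` is now closeness to a `LayeredHom L w` (free per-layer translations absorb every inner
displacement: `layeredHom_translate`); all kernels keep their shape (K2 never looks inside `NearHom`).
-/

noncomputable section

open MeasureTheory Set Metric
open Summit.AtomisticToContinuum.Crystallization.Theorems.ChartedPlanarOrderRigidityDoor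
open Summit.AtomisticToContinuum.Crystallization.Theorems.ChartedPlanarOrderDensityDichotomy
open Literature.MathematicalPhysics.StatisticalMechanics
  (triangularVec₁ triangularVec₂ haggLabel barlowOffset layerNormal IsHaggSeq)

namespace Summit.AtomisticToContinuum.Crystallization.Theorems.ChartedPlanarOrderMesoCut

/-! ## 1. Door configurations; the door-restricted BULK -/

/-- `S` is a DOOR CONFIGURATION: rooted, `δ`-separated, and its counting measure is clean, Nash and charted (N's binders, verbatim). -/
def IsDoorSet (δ : ℝ) (S : Set E3) : Prop :=
  (0 : E3) ∈ S ∧ IsSep δ S ∧ IsClean (μS S) ∧ IsNash (μS S) ∧ IsCharted (μS S)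

/-- **BULK|door «BulkDefectGapDoor»** — `BulkDefectGap` demanded only on ROOT WINDOWS `atomsIn (μS S) 0 R`, `R ≥ R₀(δ,θ,u)`, of door
configurations (exactly the instances K5′ consumes): a density `≥ u` of `θ`-unmatched atoms in the window forces excess-energy density
`η > 0` up to a boundary term. -/
def BulkDefectGapDoor : Prop :=
  ∀ δ : ℝ, 0 < δ → ∀ θ : ℝ, 0 < θ → θ ≤ 1 / 16 → ∀ u : ℝ, 0 < u → u ≤ 1 →
    ∃ η : ℝ, 0 < η ∧ ∃ C : ℝ, 0 ≤ C ∧ ∃ r : ℝ, 0 < r ∧ ∃ R₀ : ℝ, 1 ≤ R₀ ∧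
      ∀ S : Set E3, IsDoorSet δ S → ∀ R : ℝ, R₀ ≤ R →
        u * nK (atomsIn (μS S) 0 R) ≤ nBad θ S (atomsIn (μS S) 0 R) →
        η * nK (atomsIn (μS S) 0 R) ≤ excess S (atomsIn (μS S) 0 R) + C * nBdry r S (atomsIn (μS S) 0 R)

/-! ## 2. Near-homogeneous chunks (the D1 vocabulary of this cut) and the two pieces -/

/-- the `r`-environment of `x` in `S` and the `r`-environment of `y` in `H` are `τ`-close after translating both centres to the origin
(two-sided matching). -/
def EnvClose (τ r : ℝ) (S : Set E3) (x : E3) (H : Set E3) (y : E3) : Prop :=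
  (∀ p ∈ S, dist p x ≤ r → ∃ q ∈ H, dist (p - x) (q - y) ≤ τ) ∧
  (∀ q ∈ H, dist q y ≤ r → ∃ p ∈ S, dist (p - x) (q - y) ≤ τ)

/-- **LayeredHom** (v2, critic row 385 C′ «INNER DISPLACEMENT»): a homogeneously deformed LAYERED structure with FREE per-layer rigid
translations — layer `m` is the image under the ONE linear map `L` of the unit triangular lattice, translated by an arbitrary vector `w m`
(lateral registry, inner displacement AND height all sit in `w m`; the hollow-site registry is NOT enforced by the parametrisation —
cleanliness / `EnvClose` enforce it).  hcp under in-plane shear relaxes by an inner displacement of the B layers against the A layers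
(≈ 0.85·ε·a₀, critic r385), which NO `HomStacking` represents but every `LayeredHom` does; `HomStacking L s z` is the special case
`w m = L (haggLabel s m • barlowOffset 1 + z m • layerNormal 1)` (`homStacking_eq_layeredHom`). -/
def LayeredHom (L : E3 →L[ℝ] E3) (w : ℤ → E3) : Set E3 :=
  {p | ∃ m i j : ℤ, p = L (((i : ℝ) • triangularVec₁ 1) + ((j : ℝ) • triangularVec₂ 1)) + w m}

/-- layer `m` of `LayeredHom L w`. -/
def layerOf (L : E3 →L[ℝ] E3) (w : ℤ → E3) (m : ℤ) : Set E3 :=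
  {p | ∃ i j : ℤ, p = L (((i : ℝ) • triangularVec₁ 1) + ((j : ℝ) • triangularVec₂ 1)) + w m}

/-- a layered structure is the union of its layers. -/
theorem layeredHom_eq_iUnion (L : E3 →L[ℝ] E3) (w : ℤ → E3) : LayeredHom L w = ⋃ m, layerOf L w m := by
  ext p
  simp only [LayeredHom, layerOf, Set.mem_setOf_eq, Set.mem_iUnion]

/-- a per-layer translation field `v` acts on layer `m` by `· + v m` … -/
theorem layerOf_translate (L : E3 →L[ℝ] E3) (w v : ℤ → E3) (m : ℤ) :
    layerOf L (fun m => w m + v m) m = (fun p => p + v m) '' layerOf L w m := by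
  ext p
  simp only [layerOf, Set.mem_setOf_eq, Set.mem_image]
  constructor
  · rintro ⟨i, j, rfl⟩
    exact ⟨_, ⟨i, j, rfl⟩, by simp only [add_assoc]⟩
  · rintro ⟨q, ⟨i, j, rfl⟩, rfl⟩
    exact ⟨i, j, by simp only [add_assoc]⟩

/-- … and **per-layer translation fields are absorbed** by the family: translating every layer of `LayeredHom L w` by its own vector
`v m` gives `LayeredHom L (w + v)` (critic row 385 (2): `nearHom'_of_layerTranslate`). -/
theorem layeredHom_translate (L : E3 →L[ℝ] E3) (w v : ℤ → E3) :
    LayeredHom L (fun m => w m + v m) = ⋃ m, (fun p => p + v m) '' layerOf L w m := by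
  rw [layeredHom_eq_iUnion]
  exact Set.iUnion_congr fun m => layerOf_translate L w v m

/-- lens-2's homogeneous Hägg stackings are `LayeredHom`s (the per-layer translation being the hollow offset plus the height). -/
theorem homStacking_eq_layeredHom (L : E3 →L[ℝ] E3) (s : ℤ → ℤ) (z : ℤ → ℝ) :
    HomStacking L s z = LayeredHom L (fun m => L (((haggLabel s m : ℝ) • barlowOffset 1) + (z m • layerNormal 1))) := by
  ext p
  simp only [HomStacking, LayeredHom, Set.mem_setOf_eq, ← map_add]
  constructor
  · rintro ⟨m, i, j, rfl⟩
    exact ⟨m, i, j, by congr 1; abel⟩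
  · rintro ⟨m, i, j, rfl⟩
    exact ⟨m, i, j, by congr 1; abel⟩

/-- **(τ, r)-near-homogeneous chunk** (v2): ONE homogeneously deformed layered structure `H = LayeredHom L w` (free per-layer translations)
and an injective site assignment `Ψ : Q → H` under which every atom of `Q` has its `r`-environment in `S` `τ`-close to the `r`-environment
of `Ψ x` in `H`. -/
def NearHom (τ r : ℝ) (S Q : Set E3) : Prop :=
  ∃ (L : E3 →L[ℝ] E3) (w : ℤ → E3),
    ∃ Ψ : E3 → E3, Set.InjOn Ψ Q ∧ Set.MapsTo Ψ Q (LayeredHom L w) ∧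
      ∀ x ∈ Q, EnvClose τ r S x (LayeredHom L w) (Ψ x)

/-- v1's notion (near ONE of lens-2's `HomStacking L s z`, `s` Hägg), kept for comparison: it is STRONGER (`nearHom_of_nearHomStacking`). -/
def NearHomStacking (τ r : ℝ) (S Q : Set E3) : Prop :=
  ∃ (L : E3 →L[ℝ] E3) (s : ℤ → ℤ) (z : ℤ → ℝ), IsHaggSeq s ∧
    ∃ Ψ : E3 → E3, Set.InjOn Ψ Q ∧ Set.MapsTo Ψ Q (HomStacking L s z) ∧
      ∀ x ∈ Q, EnvClose τ r S x (HomStacking L s z) (Ψ x)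

/-- near a `HomStacking` ⇒ near a `LayeredHom` (v1 special case of v2). -/
theorem nearHom_of_nearHomStacking {τ r : ℝ} {S Q : Set E3} (h : NearHomStacking τ r S Q) : NearHom τ r S Q := by
  obtain ⟨L, s, z, -, Ψ, hinj, hmaps, henv⟩ := h
  refine ⟨L, fun m => L (((haggLabel s m : ℝ) • barlowOffset 1) + (z m • layerNormal 1)), Ψ, hinj, ?_, fun x hx => ?_⟩
  · rw [← homStacking_eq_layeredHom]; exact hmaps
  · rw [← homStacking_eq_layeredHom]; exact henv x hx

/-- `NearHom` is monotone in the chunk. -/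
theorem nearHom_mono {τ r : ℝ} {S Q Q' : Set E3} (h : NearHom τ r S Q) (hQ : Q' ⊆ Q) : NearHom τ r S Q' := by
  obtain ⟨L, w, Ψ, hinj, hmaps, henv⟩ := h
  exact ⟨L, w, Ψ, hinj.mono hQ, hmaps.mono_left hQ, fun x hx => henv x (hQ hx)⟩

/-- **HBG♮ «NearHomBulkGap»** (WEAKER than BULK, K0; census TAG 139′ HBC-CERT′ on the INNER-RELAXED homogeneous energies, critic r385 (3), + CB-locality): per tolerance `θ` an energy density
`η(δ,θ) > 0` such that, for every bulk slack `ε > 0`, at some homogeneity precision `(τ, r)` and boundary thickness `r'`: a clean finite chunk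
of a `δ`-separated configuration which is `(τ, r)`-near-homogeneous and ENTIRELY `θ`-unmatched has excess `≥ η·#Q − C·#bdry − ε·#Q`. -/
def NearHomBulkGap : Prop :=
  ∀ δ : ℝ, 0 < δ → ∀ θ : ℝ, 0 < θ → θ ≤ 1 / 16 → ∃ η : ℝ, 0 < η ∧ ∀ ε : ℝ, 0 < ε →
    ∃ τ : ℝ, 0 < τ ∧ ∃ r : ℝ, 0 < r ∧ ∃ C : ℝ, 0 ≤ C ∧ ∃ r' : ℝ, 0 < r' ∧
      ∀ S Q : Set E3, IsSep δ S → IsCleanChunk S Q → NearHom τ r S Q → nK Q ≤ nBad θ S Q →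
        η * nK Q ≤ excess S Q + C * nBdry r' S Q + ε * nK Q

/-- **RED♮ «MesoHomogenisation»** (Nash-ESSENTIAL, GS-free, energy-free; the XL core of this cut; census TAG 138 (ii) LH-ellipticity across the
clean window): per `(δ, θ, u)` a transferred tolerance `θ' ∈ (0, 1/16]` and a mass fraction `c₀ > 0` such that for every requested precision
`(τ, r)`, boundary thickness `r'` and slack `ε` there are `C, R₀` with: in every DOOR configuration and every root window of radius `R ≥ R₀`
whose `θ`-bad density is `≥ u`, some finite family `T` of pairwise disjoint sub-chunks of the window consists of `(τ, r)`-near-homogeneous,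
ENTIRELY `θ'`-bad chunks, carries `≥ c₀·#window` atoms, and has total `r'`-boundary (chunks + remainder) `≤ ε·#window + C·#bdry_{r'}(window)`. -/
def MesoHomogenisation : Prop :=
  ∀ δ : ℝ, 0 < δ → ∀ θ : ℝ, 0 < θ → θ ≤ 1 / 16 → ∀ u : ℝ, 0 < u → u ≤ 1 →
    ∃ θ' : ℝ, 0 < θ' ∧ θ' ≤ 1 / 16 ∧ ∃ c₀ : ℝ, 0 < c₀ ∧
    ∀ τ : ℝ, 0 < τ → ∀ r : ℝ, 0 < r → ∀ r' : ℝ, 0 < r' → ∀ ε : ℝ, 0 < ε →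
      ∃ C : ℝ, 0 ≤ C ∧ ∃ R₀ : ℝ, 1 ≤ R₀ ∧ ∀ S : Set E3, IsDoorSet δ S → ∀ R : ℝ, R₀ ≤ R →
        u * nK (atomsIn (μS S) 0 R) ≤ nBad θ S (atomsIn (μS S) 0 R) →
        ∃ T : Finset (Set E3),
          (∀ Q ∈ T, Q ⊆ atomsIn (μS S) 0 R) ∧ (↑T : Set (Set E3)).PairwiseDisjoint id ∧
          (∀ Q ∈ T, NearHom τ r S Q) ∧ (∀ Q ∈ T, nK Q ≤ nBad θ' S Q) ∧
          c₀ * nK (atomsIn (μS S) 0 R) ≤ ∑ Q ∈ T, nK Q ∧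
          (∑ Q ∈ T, nBdry r' S Q) + nBdry r' S (atomsIn (μS S) 0 R \ ⋃₀ (↑T : Set (Set E3)))
            ≤ ε * nK (atomsIn (μS S) 0 R) + C * nBdry r' S (atomsIn (μS S) 0 R)

/-! ## 3. Bookkeeping lemmas -/

/-- `∑ᶠ_{p ∈ s} 1 = #s` in `ℝ` (both sides vanish for infinite `s`). -/
theorem finsum_mem_one_real' (s : Set E3) : ∑ᶠ _p ∈ s, (1 : ℝ) = (s.ncard : ℝ) := by
  rcases s.finite_or_infinite with hs | hs
  · rw [finsum_mem_eq_finite_toFinset_sum _ hs, Finset.sum_const, nsmul_eq_mul, mul_one,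
      Set.ncard_eq_toFinset_card s hs]
  · rw [hs.ncard, Nat.cast_zero]
    exact finsum_mem_eq_zero_of_infinite (by simpa [Function.support_const one_ne_zero] using hs)

/-- `nK K` as a `finsum` of ones. -/
theorem nK_eq_finsum (K : Set E3) : nK K = ∑ᶠ _p ∈ K, (1 : ℝ) := (finsum_mem_one_real' K).symm

/-- finsum over a finite chunk = (sum over a disjoint finite family of sub-chunks) + (finsum over the remainder). -/
theorem finsum_partition (f : E3 → ℝ) {K : Set E3} (hK : K.Finite) (T : Finset (Set E3))
    (hsub : ∀ Q ∈ T, Q ⊆ K) (hdisj : (↑T : Set (Set E3)).PairwiseDisjoint id) :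
    ∑ᶠ x ∈ K, f x = (∑ Q ∈ T, ∑ᶠ x ∈ Q, f x) + ∑ᶠ x ∈ K \ ⋃₀ (↑T : Set (Set E3)), f x := by
  have hU : ⋃₀ (↑T : Set (Set E3)) ⊆ K := Set.sUnion_subset fun Q hQ => hsub Q hQ
  have hUfin : (⋃₀ (↑T : Set (Set E3))).Finite := hK.subset hU
  have hDfin : (K \ ⋃₀ (↑T : Set (Set E3))).Finite := hK.subset Set.sdiff_subset
  have hsplit : ⋃₀ (↑T : Set (Set E3)) ∪ (K \ ⋃₀ (↑T : Set (Set E3))) = K := Set.union_sdiff_cancel hU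
  have hdj : Disjoint (⋃₀ (↑T : Set (Set E3))) (K \ ⋃₀ (↑T : Set (Set E3))) :=
    Set.disjoint_left.2 fun x hx hx' => hx'.2 hx
  conv_lhs => rw [← hsplit]
  rw [finsum_mem_union hdj hUfin hDfin,
    finsum_mem_sUnion hdisj T.finite_toSet (fun Q hQ => hK.subset (hsub Q hQ)), finsum_mem_coe_finset]

/-- additivity of `nK` over a finite partition. -/
theorem nK_partition {K : Set E3} (hK : K.Finite) (T : Finset (Set E3))
    (hsub : ∀ Q ∈ T, Q ⊆ K) (hdisj : (↑T : Set (Set E3)).PairwiseDisjoint id) :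
    nK K = (∑ Q ∈ T, nK Q) + nK (K \ ⋃₀ (↑T : Set (Set E3))) := by
  simp only [nK_eq_finsum]
  exact finsum_partition (fun _ => (1 : ℝ)) hK T hsub hdisj

/-- additivity of the excess over a finite partition. -/
theorem excess_partition (S : Set E3) {K : Set E3} (hK : K.Finite) (T : Finset (Set E3))
    (hsub : ∀ Q ∈ T, Q ⊆ K) (hdisj : (↑T : Set (Set E3)).PairwiseDisjoint id) :
    excess S K = (∑ Q ∈ T, excess S Q) + excess S (K \ ⋃₀ (↑T : Set (Set E3))) :=
  finsum_partition _ hK T hsub hdisj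

/-- the root window of a door configuration is a clean finite chunk. -/
theorem isCleanChunk_window {δ : ℝ} (hδ : 0 < δ) {S : Set E3} (hS : IsDoorSet δ S) (R : ℝ) :
    IsCleanChunk S (atomsIn (μS S) 0 R) := by
  obtain ⟨-, hsep, hclean, -, -⟩ := hS
  have hatom : ∀ p : E3, (μS S) {p} ≠ 0 ↔ p ∈ S := fun p =>
    Literature.Probability.Process.count_restrict_singleton_ne_zero_iff S p
  have hKS : atomsIn (μS S) 0 R ⊆ S := fun p hp => (hatom p).1 hp.1
  have hKfin : (atomsIn (μS S) 0 R).Finite := by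
    have hf : (Metric.closedBall (0 : E3) R ∩ S).Finite :=
      Literature.Probability.Process.LocalConfig.finite_inter_of_separated hδ hsep (isCompact_closedBall (0 : E3) R)
    exact hf.subset fun p hp => ⟨Metric.mem_closedBall.2 hp.2, (hatom p).1 hp.1⟩
  refine ⟨hKS, hKfin, fun x hx => ?_⟩
  have h1 := hclean x hx.1
  have hset : {p : EuclideanSpace ℝ (Fin 3) | (μS S) {p} ≠ 0} = S := by
    ext p; exact hatom p
  rw [hset] at h1
  exact h1

/-- sub-chunks of clean chunks are clean. -/
theorem isCleanChunk_mono {S K Q : Set E3} (hK : IsCleanChunk S K) (hQ : Q ⊆ K) : IsCleanChunk S Q :=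
  ⟨hQ.trans hK.1, hK.2.1.subset hQ, fun x hx => hK.2.2 x (hQ hx)⟩

/-! ## 4. KERNELS (0 sorry) -/

/-- **K0** BULK ⟹ HBG♮ (restriction to near-homogeneous all-bad chunks, `u = 1`; the slack and the precision are not even used). -/
theorem nearHomBulkGap_of_bulk (hB : BulkDefectGap) : NearHomBulkGap := by
  intro δ hδ θ hθ hθ'
  obtain ⟨η, hη, C, hC, r, hr, h⟩ := hB δ hδ θ hθ hθ' 1 one_pos le_rfl
  refine ⟨η, hη, fun ε hε => ⟨1, one_pos, 1, one_pos, C, hC, r, hr, fun S Q hS hQ _ hall => ?_⟩⟩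
  have h1 := h S Q hS hQ (by simpa using hall)
  have h2 : 0 ≤ ε * nK Q := mul_nonneg hε.le (nK_nonneg Q)
  linarith

/-- **K1** BULK ⟹ BULK|door (restriction to root windows of door configurations, `R₀ = 1`). -/
theorem bulkDoor_of_bulk (hB : BulkDefectGap) : BulkDefectGapDoor := by
  intro δ hδ θ hθ hθ' u hu hu1
  obtain ⟨η, hη, C, hC, r, hr, h⟩ := hB δ hδ θ hθ hθ' u hu hu1
  exact ⟨η, hη, C, hC, r, hr, 1, le_rfl, fun S hS R _ hd => h S _ hS.2.1 (isCleanChunk_window hδ hS R) hd⟩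

/-- hence R⋆ ⟹ BULK|door along the tree chain R⋆ → R⋆♭ → RATE′ → BULK. -/
theorem bulkDoor_of_rigidity (hR : DiscreteBarlowRigidity) : BulkDefectGapDoor :=
  bulkDoor_of_bulk (bulk_of_rate (rate_of_flat (flat_of_rigidity hR)))

/-- **K2 ★ THE CUT**: Floor♭ ∧ HBG♮ ∧ RED♮ ⟹ BULK|door.
Bookkeeping: HBG♮ on each sub-chunk of the family, Floor♭ on the remainder, the two partition identities, and the boundary accounting of RED♮;
constants `ε₁ = η c₀/4` (bulk slack of HBG♮ and Floor♭), `ε₂ = η c₀/(4(C₁+C₂+1))` (boundary slack requested from RED♮), output density `η c₀/2`. -/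
theorem bulkDoor_of_meso (hFl : ChunkFloor) (hG : NearHomBulkGap) (hM : MesoHomogenisation) : BulkDefectGapDoor := by
  intro δ hδ θ hθ hθ' u hu hu1
  obtain ⟨θ', hθ'0, hθ'1, c₀, hc₀, hM'⟩ := hM δ hδ θ hθ hθ' u hu hu1
  obtain ⟨η, hη, hG'⟩ := hG δ hδ θ' hθ'0 hθ'1
  obtain ⟨τ, hτ, r, hr, C₁, hC₁, r₁, hr₁, hG''⟩ := hG' (η * c₀ / 4) (by positivity)
  obtain ⟨C₂, hC₂, r₂, hr₂, hFl'⟩ := hFl δ hδ (η * c₀ / 4) (by positivity)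
  have hr' : 0 < max r₁ r₂ := lt_max_of_lt_left hr₁
  have hCpos : 0 < C₁ + C₂ + 1 := by linarith
  obtain ⟨C₃, hC₃, R₀, hR₀, hM''⟩ := hM' τ hτ r hr (max r₁ r₂) hr' (η * c₀ / (4 * (C₁ + C₂ + 1))) (by positivity)
  refine ⟨η * c₀ / 2, by positivity, (C₁ + C₂ + 1) * C₃, by positivity, max r₁ r₂, hr', R₀, hR₀, ?_⟩
  intro S hS R hR hdense
  obtain ⟨T, hTsub, hTdisj, hThom, hTbad, hTmass, hTbdry⟩ := hM'' S hS R hR hdense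
  have hKclean : IsCleanChunk S (atomsIn (μS S) 0 R) := isCleanChunk_window hδ hS R
  have hKfin : (atomsIn (μS S) 0 R).Finite := hKclean.2.1
  obtain ⟨-, hsep, -, -, -⟩ := hS
  -- HBG♮ on every sub-chunk of the family
  have hQ : ∀ Q ∈ T, η * nK Q ≤ excess S Q + C₁ * nBdry (max r₁ r₂) S Q + η * c₀ / 4 * nK Q := by
    intro Q hQT
    have h := hG'' S Q hsep (isCleanChunk_mono hKclean (hTsub Q hQT)) (hThom Q hQT) (hTbad Q hQT)
    have hmono : nBdry r₁ S Q ≤ nBdry (max r₁ r₂) S Q := nBdry_mono (le_max_left _ _) (hKfin.subset (hTsub Q hQT))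
    have := mul_le_mul_of_nonneg_left hmono hC₁
    linarith
  have hsum : η * ∑ Q ∈ T, nK Q ≤
      (∑ Q ∈ T, excess S Q) + C₁ * (∑ Q ∈ T, nBdry (max r₁ r₂) S Q) + η * c₀ / 4 * ∑ Q ∈ T, nK Q := by
    rw [Finset.mul_sum, Finset.mul_sum, Finset.mul_sum, ← Finset.sum_add_distrib, ← Finset.sum_add_distrib]
    exact Finset.sum_le_sum fun Q hQT => hQ Q hQT
  -- Floor♭ on the remainder
  have hrestfin : (atomsIn (μS S) 0 R \ ⋃₀ (↑T : Set (Set E3))).Finite := hKfin.subset Set.sdiff_subset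
  have hfloor : 0 ≤ excess S (atomsIn (μS S) 0 R \ ⋃₀ (↑T : Set (Set E3))) +
      C₂ * nBdry (max r₁ r₂) S (atomsIn (μS S) 0 R \ ⋃₀ (↑T : Set (Set E3))) +
      η * c₀ / 4 * nK (atomsIn (μS S) 0 R \ ⋃₀ (↑T : Set (Set E3))) := by
    have h := hFl' S hsep _ (Set.sdiff_subset.trans hKclean.1) hrestfin
    have hmono : nBdry r₂ S (atomsIn (μS S) 0 R \ ⋃₀ (↑T : Set (Set E3))) ≤
        nBdry (max r₁ r₂) S (atomsIn (μS S) 0 R \ ⋃₀ (↑T : Set (Set E3))) := nBdry_mono (le_max_right _ _) hrestfin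
    have := mul_le_mul_of_nonneg_left hmono hC₂
    linarith
  -- the partition identities
  have hex := excess_partition S hKfin T hTsub hTdisj
  have hnk := nK_partition hKfin T hTsub hTdisj
  -- boundary accounting, scaled
  have hB0 : 0 ≤ ∑ Q ∈ T, nBdry (max r₁ r₂) S Q := Finset.sum_nonneg fun Q _ => nBdry_nonneg _ S Q
  have hBr0 : 0 ≤ nBdry (max r₁ r₂) S (atomsIn (μS S) 0 R \ ⋃₀ (↑T : Set (Set E3))) := nBdry_nonneg _ S _
  have hscaled := mul_le_mul_of_nonneg_left hTbdry hCpos.le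
  have hε₂ : (C₁ + C₂ + 1) * (η * c₀ / (4 * (C₁ + C₂ + 1))) = η * c₀ / 4 := by
    field_simp
  have hmass := mul_le_mul_of_nonneg_left hTmass hη.le
  have hnk' : η * c₀ / 4 * nK (atomsIn (μS S) 0 R) =
      η * c₀ / 4 * (∑ Q ∈ T, nK Q) + η * c₀ / 4 * nK (atomsIn (μS S) 0 R \ ⋃₀ (↑T : Set (Set E3))) := by
    rw [hnk]; ring
  have hbd : (C₁ + C₂ + 1) * ((∑ Q ∈ T, nBdry (max r₁ r₂) S Q) +
      nBdry (max r₁ r₂) S (atomsIn (μS S) 0 R \ ⋃₀ (↑T : Set (Set E3)))) ≤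
      η * c₀ / 4 * nK (atomsIn (μS S) 0 R) + (C₁ + C₂ + 1) * C₃ * nBdry (max r₁ r₂) S (atomsIn (μS S) 0 R) := by
    have : (C₁ + C₂ + 1) * (η * c₀ / (4 * (C₁ + C₂ + 1)) * nK (atomsIn (μS S) 0 R) +
        C₃ * nBdry (max r₁ r₂) S (atomsIn (μS S) 0 R)) =
        η * c₀ / 4 * nK (atomsIn (μS S) 0 R) + (C₁ + C₂ + 1) * C₃ * nBdry (max r₁ r₂) S (atomsIn (μS S) 0 R) := by
      rw [mul_add, ← mul_assoc, hε₂]; ring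
    linarith [hscaled, this]
  have hcross : C₁ * (∑ Q ∈ T, nBdry (max r₁ r₂) S Q) +
      C₂ * nBdry (max r₁ r₂) S (atomsIn (μS S) 0 R \ ⋃₀ (↑T : Set (Set E3))) ≤
      (C₁ + C₂ + 1) * ((∑ Q ∈ T, nBdry (max r₁ r₂) S Q) +
        nBdry (max r₁ r₂) S (atomsIn (μS S) 0 R \ ⋃₀ (↑T : Set (Set E3)))) := by
    nlinarith [hB0, hBr0, hC₁, hC₂]
  nlinarith [hsum, hfloor, hex, hnk', hbd, hcross, hmass]

end Summit.AtomisticToContinuum.Crystallization.Theorems.ChartedPlanarOrderMesoCut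

end
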